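import Summits.KontsevichZagierPeriods.KontsevichZagierPeriods.Theorems.FurushoPentagonPentagonInKZCornerEngineExistQ
import Summits.KontsevichZagierPeriods.KontsevichZagierPeriods.Theorems.FurushoPentagonPentagonInKZCornerEngineExistEAux
import Summits.KontsevichZagierPeriods.KontsevichZagierPeriods.Theorems.FurushoPentagonPentagonInKZSimplexToCube
import Literature.NumberTheory.Transcendental.KZLogCalculusProofs

/-!
# `PentagonInKZ`, line `edge-normal-newton-leibniz`: corner engine — existence of the height differences `Q a` and of the level-`(n−2)` terms `E a`

Helper file for the proof of `cornerEngine_uniformlyNull` (crux `FurushoPentagon.PentagonInKZ`,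
stmt-KontsevichZagierPeriods-11348), in the ABSTRACT ENGINE signature: the engine lemma
`exists_stepA_QE`.  Both families are representations on closed unit cubes whose integrands are
`ℚ`-semialgebraic (total functions) and bounded on the OPEN cube (the boundary is a null set):
* `Q a`: at an open point, `ρ = σ Ξ` and the master bound give
  `|ρ| · |fd_a B(Ξ₁,Η₁) − fd_a B(Ξ₁,0)| ≤ |σ| Ξ · K Η ≤ K C₀`;
* `E a`: at an open point with `Ξ Η ≠ 0` one has `0 < Ξ₂ ≤ α`, `0 < Η₂ < β`, reverse peeling turns
  the integrand into `ρ₂ fd_a(Ξ₂,Η₂) B^{μ∘op a}_{k,l+1}(x, Η₂/β :: y; Ξ₂, β) / β`, and the master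
  bound in degree `(k, l+1)` (where `B(·, 0) = 0`) gives `≤ C₀ K`.

References: [Drinfeld1991, §2], [KontsevichZagier2001, §1.1].
-/

noncomputable section

open Set MeasureTheory
open Literature.NumberTheory.Transcendental
open Literature.ModelTheory.ExponentialFields (IsSemialgebraic)

namespace Summit.KontsevichZagierPeriods.FurushoPentagon.PentagonInKZ

/-- Almost every point of the closed cube lies in the open cube (worker copy). [folklore] -/
theorem qe_ae_mem_openUnitCube {d : ℕ} :
    ∀ᵐ z ∂(volume.restrict (KZ.cube d)), z ∈ openUnitCube d := by
  rw [ae_restrict_iff' KZ.measurableSet_cube]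
  have h0 := SimplexToCube.volume_cube_diff_openUnitCube d
  rw [measure_eq_zero_iff_ae_notMem] at h0
  filter_upwards [h0] with z hz hzc
  by_contra h
  exact hz ⟨hzc, h⟩

/-- **A semialgebraic function on the closed unit cube bounded on the open cube is the integrand
of a representation** (domain the cube; worker copy of `CornerCubes.exists_rep_cube_of_bound`).
[cite: KontsevichZagier2001, §1.1] -/
theorem qe_exists_rep_cube_of_bound {d : ℕ} (g : (Fin d → ℝ) → ℝ)
    (hg : IsSemialgebraicFunOn ℚ (KZ.cube d) g) (hb : ∃ C : ℝ, ∀ z ∈ openUnitCube d, |g z| ≤ C) :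
    ∃ r : KZ.IntegralRep d, r.domain = KZ.cube d ∧ r.integrand = g := by
  obtain ⟨C, hC⟩ := hb
  refine ⟨⟨KZ.cube d, g, KZ.isSemialgebraic_cube, hg, ?_⟩, rfl, rfl⟩
  have hvol : volume (KZ.cube d) ≠ ⊤ := by
    rw [KZ.cube_eq_Icc]; exact measure_Icc_lt_top.ne
  refine ⟨KZ.aestronglyMeasurable_of_isSemialgebraicFunOn hg KZ.measurableSet_cube,
    HasFiniteIntegral.restrict_of_bounded (C := C) hvol.lt_top ?_⟩
  filter_upwards [qe_ae_mem_openUnitCube] with z hz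
  rw [Real.norm_eq_abs]; exact hC z hz

section AbstractEngine

variable {m N : ℕ} {ℓ ℓ' : Fin (m + 2)} {α β : ℚ}
  {Zq : Fin (m + 2) → (DrinfeldKohnoTrunc ℚ (Fin 4) N)} {wZ : ∀ {n : ℕ}, (Fin n → Fin (m + 2)) → (DrinfeldKohnoTrunc ℚ (Fin 4) N)}
  {fd gd dd : Fin (m + 2) → ℝ → ℝ → ℝ}
  {Ht Vt dHt dVt : ∀ {n : ℕ}, (Fin n → Fin (m + 2)) → (Fin n → ℝ) → ℝ → ℝ → ℝ}
  {op opV : Fin (m + 2) → (DrinfeldKohnoTrunc ℚ (Fin 4) N) →ₗ[ℚ] (DrinfeldKohnoTrunc ℚ (Fin 4) N)}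
  {Af Bf dAf dBf F : ((DrinfeldKohnoTrunc ℚ (Fin 4) N) →ₗ[ℚ] ℚ) → ∀ {k l : ℕ}, (Fin k → ℝ) → (Fin l → ℝ) → ℝ → ℝ → ℝ}
  {Xb : ∀ k l e : ℕ, (Fin (k + l + e) → ℝ) → Fin k → ℝ}
  {Yb : ∀ k l e : ℕ, (Fin (k + l + e) → ℝ) → Fin l → ℝ}
  {Θb : ∀ k l e : ℕ, (Fin (k + l + e) → ℝ) → Fin e → ℝ}

variable (H :
    (∀ {n : ℕ} (U : Fin n → Fin (m + 2)), wZ U = ((List.ofFn U).map Zq).prod) ∧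
    (∀ (a : Fin (m + 2)) (X : (DrinfeldKohnoTrunc ℚ (Fin 4) N)), op a X = if a = ℓ then Zq ℓ * X - X * Zq ℓ else Zq a * X) ∧
    (∀ (b : Fin (m + 2)) (X : (DrinfeldKohnoTrunc ℚ (Fin 4) N)), opV b X = if b = ℓ' then Zq ℓ' * X - X * Zq ℓ' else Zq b * X) ∧
    (∀ (μ : (DrinfeldKohnoTrunc ℚ (Fin 4) N) →ₗ[ℚ] ℚ) {k l : ℕ} (x : Fin k → ℝ) (y : Fin l → ℝ) (ξ η : ℝ), Af μ x y ξ η = ∑ U : Fin k → Fin (m + 2), ∑ V : Fin l → Fin (m + 2), (μ (wZ U * wZ V) : ℝ) * (Ht U x ξ η * Vt V y 0 η)) ∧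
    (∀ (μ : (DrinfeldKohnoTrunc ℚ (Fin 4) N) →ₗ[ℚ] ℚ) {k l : ℕ} (x : Fin k → ℝ) (y : Fin l → ℝ) (ξ η : ℝ), Bf μ x y ξ η = ∑ U : Fin k → Fin (m + 2), ∑ V : Fin l → Fin (m + 2), (μ (wZ V * wZ U) : ℝ) * (Vt V y ξ η * Ht U x ξ 0)) ∧
    (∀ (μ : (DrinfeldKohnoTrunc ℚ (Fin 4) N) →ₗ[ℚ] ℚ) {k l : ℕ} (x : Fin k → ℝ) (y : Fin l → ℝ) (ξ η : ℝ), dAf μ x y ξ η = ∑ U : Fin k → Fin (m + 2), ∑ V : Fin l → Fin (m + 2), (μ (wZ U * wZ V) : ℝ) * (dHt U x ξ η * Vt V y 0 η)) ∧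
    (∀ (μ : (DrinfeldKohnoTrunc ℚ (Fin 4) N) →ₗ[ℚ] ℚ) {k l : ℕ} (x : Fin k → ℝ) (y : Fin l → ℝ) (ξ η : ℝ), dBf μ x y ξ η = ∑ U : Fin k → Fin (m + 2), ∑ V : Fin l → Fin (m + 2), (μ (wZ V * wZ U) : ℝ) * (dVt V y ξ η * Ht U x ξ 0)) ∧
    (∀ (μ : (DrinfeldKohnoTrunc ℚ (Fin 4) N) →ₗ[ℚ] ℚ) {k l : ℕ} (x : Fin k → ℝ) (y : Fin l → ℝ) (ξ η : ℝ), F μ x y ξ η = Af μ x y ξ η - Bf μ x y ξ η) ∧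
    (∀ (k l e : ℕ) (z : Fin (k + l + e) → ℝ), Xb k l e z = fun i => z (Fin.castAdd e (Fin.castAdd l i))) ∧
    (∀ (k l e : ℕ) (z : Fin (k + l + e) → ℝ), Yb k l e z = fun j => z (Fin.castAdd e (Fin.natAdd k j))) ∧
    (∀ (k l e : ℕ) (z : Fin (k + l + e) → ℝ), Θb k l e z = fun s => z (Fin.natAdd (k + l) s)) ∧
    (∀ (U : Fin 0 → Fin (m + 2)) (x : Fin 0 → ℝ) (ξ η : ℝ), Ht U x ξ η = 1) ∧
    (∀ (V : Fin 0 → Fin (m + 2)) (y : Fin 0 → ℝ) (ξ η : ℝ), Vt V y ξ η = 1) ∧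
    (∀ (U : Fin 0 → Fin (m + 2)) (x : Fin 0 → ℝ) (ξ η : ℝ), dHt U x ξ η = 0) ∧
    (∀ (V : Fin 0 → Fin (m + 2)) (y : Fin 0 → ℝ) (ξ η : ℝ), dVt V y ξ η = 0) ∧
    (∀ {k : ℕ} (U : Fin (k + 1) → Fin (m + 2)) (x : Fin (k + 1) → ℝ) (η : ℝ), Ht U x 0 η = 0) ∧
    (∀ {l : ℕ} (V : Fin (l + 1) → Fin (m + 2)) (y : Fin (l + 1) → ℝ) (ξ : ℝ), Vt V y ξ 0 = 0) ∧
    (∀ t y : ℝ, fd ℓ t y = 1 / t) ∧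
    (∀ x s : ℝ, gd ℓ' x s = 1 / s) ∧
    (∀ x y : ℝ, dd ℓ x y = 0) ∧
    (∀ x y : ℝ, dd ℓ' x y = 0) ∧
    (∀ (μ : (DrinfeldKohnoTrunc ℚ (Fin 4) N) →ₗ[ℚ] ℚ) {k : ℕ} (x₀ : ℝ) (x' : Fin k → ℝ) (ξ η : ℝ), ∑ U : Fin (k + 1) → Fin (m + 2), (μ (wZ U) : ℝ) * Ht U (Fin.cons x₀ x') ξ η = (∑ a : Fin (m + 2), (if a = ℓ then 1 / x₀ else ξ * fd a (ξ * x₀) η) * ∑ U' : Fin k → Fin (m + 2), (μ (Zq a * wZ U') : ℝ) * Ht U' x' (ξ * x₀) η) - (1 / x₀) * ∑ U' : Fin k → Fin (m + 2), (μ (wZ U' * Zq ℓ) : ℝ) * Ht U' x' (ξ * x₀) η) ∧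
    (∀ (μ : (DrinfeldKohnoTrunc ℚ (Fin 4) N) →ₗ[ℚ] ℚ) {l : ℕ} (y₀ : ℝ) (y' : Fin l → ℝ) (ξ η : ℝ), ∑ V : Fin (l + 1) → Fin (m + 2), (μ (wZ V) : ℝ) * Vt V (Fin.cons y₀ y') ξ η = (∑ b : Fin (m + 2), (if b = ℓ' then 1 / y₀ else η * gd b ξ (η * y₀)) * ∑ V' : Fin l → Fin (m + 2), (μ (Zq b * wZ V') : ℝ) * Vt V' y' ξ (η * y₀)) - (1 / y₀) * ∑ V' : Fin l → Fin (m + 2), (μ (wZ V' * Zq ℓ') : ℝ) * Vt V' y' ξ (η * y₀)) ∧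
    (∀ (μ : (DrinfeldKohnoTrunc ℚ (Fin 4) N) →ₗ[ℚ] ℚ) {l : ℕ} (P Q : (DrinfeldKohnoTrunc ℚ (Fin 4) N)) (y : Fin l → ℝ) (η : ℝ), (∀ i, 0 < y i ∧ y i < 1) → 0 < η → η ≤ (β : ℝ) → ∑ V : Fin l → Fin (m + 2), (μ (P * (Zq ℓ * wZ V - wZ V * Zq ℓ) * Q) : ℝ) * Vt V y 0 η = 0) ∧
    (∀ (μ : (DrinfeldKohnoTrunc ℚ (Fin 4) N) →ₗ[ℚ] ℚ) {k : ℕ} (P Q : (DrinfeldKohnoTrunc ℚ (Fin 4) N)) (x : Fin k → ℝ) (ξ : ℝ), (∀ i, 0 < x i ∧ x i < 1) → 0 < ξ → ξ ≤ (α : ℝ) → ∑ U : Fin k → Fin (m + 2), (μ (P * (Zq ℓ' * wZ U - wZ U * Zq ℓ') * Q) : ℝ) * Ht U x ξ 0 = 0) ∧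
    (∀ (μ : (DrinfeldKohnoTrunc ℚ (Fin 4) N) →ₗ[ℚ] ℚ) (P Q : (DrinfeldKohnoTrunc ℚ (Fin 4) N)), μ (P * (Zq ℓ * Zq ℓ' - Zq ℓ' * Zq ℓ) * Q) = 0) ∧
    (∀ (μ : (DrinfeldKohnoTrunc ℚ (Fin 4) N) →ₗ[ℚ] ℚ) (P Q : (DrinfeldKohnoTrunc ℚ (Fin 4) N)) (x y : ℝ), 0 < x → x < (α : ℝ) → 0 < y → y < (β : ℝ) → ∑ a : Fin (m + 2), ∑ b : Fin (m + 2), (fd a x y * gd b x y) * (μ (P * (Zq a * Zq b - Zq b * Zq a) * Q) : ℝ) = 0) ∧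
    (∀ (μ : (DrinfeldKohnoTrunc ℚ (Fin 4) N) →ₗ[ℚ] ℚ) (P Q : (DrinfeldKohnoTrunc ℚ (Fin 4) N)) (s : ℝ), 0 < s → s < (β : ℝ) → ∑ b : Fin (m + 2), gd b 0 s * (μ (P * (Zq ℓ * Zq b - Zq b * Zq ℓ) * Q) : ℝ) = 0) ∧
    (∀ (μ : (DrinfeldKohnoTrunc ℚ (Fin 4) N) →ₗ[ℚ] ℚ) (P Q : (DrinfeldKohnoTrunc ℚ (Fin 4) N)) (t : ℝ), 0 < t → t < (α : ℝ) → ∑ a : Fin (m + 2), fd a t 0 * (μ (P * (Zq ℓ' * Zq a - Zq a * Zq ℓ') * Q) : ℝ) = 0) ∧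
    (∀ (a : Fin (m + 2)) (ξ η : ℝ), 0 ≤ ξ → ξ ≤ (α : ℝ) → 0 ≤ η → η ≤ (β : ℝ) → HasDerivAt (fun y => fd a ξ y) (dd a ξ η) η) ∧
    (∀ (b : Fin (m + 2)) (ξ η : ℝ), 0 ≤ ξ → ξ ≤ (α : ℝ) → 0 ≤ η → η ≤ (β : ℝ) → HasDerivAt (fun x => gd b x η) (dd b ξ η) ξ) ∧
    (∀ {k : ℕ} (U : Fin k → Fin (m + 2)) (x : Fin k → ℝ) (ξ η : ℝ), (∀ i, 0 ≤ x i ∧ x i ≤ 1) → 0 ≤ ξ → ξ ≤ (α : ℝ) → 0 ≤ η → η ≤ (β : ℝ) → HasDerivAt (fun t => Ht U x t η) (dHt U x ξ η) ξ) ∧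
    (∀ {l : ℕ} (V : Fin l → Fin (m + 2)) (y : Fin l → ℝ) (ξ η : ℝ), (∀ i, 0 ≤ y i ∧ y i ≤ 1) → 0 ≤ ξ → ξ ≤ (α : ℝ) → 0 ≤ η → η ≤ (β : ℝ) → HasDerivAt (fun s => Vt V y ξ s) (dVt V y ξ η) η) ∧
    (∀ {k : ℕ} (U : Fin (k + 1) → Fin (m + 2)) (x₀ : ℝ) (x' : Fin k → ℝ) (ξ η : ℝ), 0 < x₀ → x₀ < 1 → (∀ i, 0 ≤ x' i ∧ x' i ≤ 1) → 0 ≤ ξ → ξ ≤ (α : ℝ) → 0 ≤ η → η ≤ (β : ℝ) → HasDerivAt (fun t => t * Ht U (Fin.cons t x') ξ η) (ξ * dHt U (Fin.cons x₀ x') ξ η) x₀) ∧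
    (∀ {l : ℕ} (V : Fin (l + 1) → Fin (m + 2)) (y₀ : ℝ) (y' : Fin l → ℝ) (ξ η : ℝ), 0 < y₀ → y₀ < 1 → (∀ i, 0 ≤ y' i ∧ y' i ≤ 1) → 0 ≤ ξ → ξ ≤ (α : ℝ) → 0 ≤ η → η ≤ (β : ℝ) → HasDerivAt (fun t => t * Vt V (Fin.cons t y') ξ η) (η * dVt V (Fin.cons y₀ y') ξ η) y₀) ∧
    (∀ {k : ℕ} (U : Fin (k + 1) → Fin (m + 2)) (x' : Fin k → ℝ) (ξ η : ℝ), (∀ i, 0 ≤ x' i ∧ x' i ≤ 1) → 0 ≤ ξ → ξ ≤ (α : ℝ) → 0 ≤ η → η ≤ (β : ℝ) → ContinuousOn (fun t => t * Ht U (Fin.cons t x') ξ η) (Set.Icc 0 1)) ∧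
    (∀ {l : ℕ} (V : Fin (l + 1) → Fin (m + 2)) (y' : Fin l → ℝ) (ξ η : ℝ), (∀ i, 0 ≤ y' i ∧ y' i ≤ 1) → 0 ≤ ξ → ξ ≤ (α : ℝ) → 0 ≤ η → η ≤ (β : ℝ) → ContinuousOn (fun t => t * Vt V (Fin.cons t y') ξ η) (Set.Icc 0 1)) ∧
    (∀ {d : ℕ} {W : Set (Fin d → ℝ)}, IsSemialgebraic ℚ W → ∀ (a : Fin (m + 2)) {T Y : (Fin d → ℝ) → ℝ}, IsSemialgebraicFunOn ℚ W T → IsSemialgebraicFunOn ℚ W Y → IsSemialgebraicFunOn ℚ W fun z => fd a (T z) (Y z)) ∧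
    (∀ {d : ℕ} {W : Set (Fin d → ℝ)}, IsSemialgebraic ℚ W → ∀ (b : Fin (m + 2)) {T Y : (Fin d → ℝ) → ℝ}, IsSemialgebraicFunOn ℚ W T → IsSemialgebraicFunOn ℚ W Y → IsSemialgebraicFunOn ℚ W fun z => gd b (T z) (Y z)) ∧
    (∀ {d : ℕ} {W : Set (Fin d → ℝ)}, IsSemialgebraic ℚ W → ∀ (a : Fin (m + 2)) {T Y : (Fin d → ℝ) → ℝ}, IsSemialgebraicFunOn ℚ W T → IsSemialgebraicFunOn ℚ W Y → IsSemialgebraicFunOn ℚ W fun z => dd a (T z) (Y z)) ∧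
    (∀ {d : ℕ} {W : Set (Fin d → ℝ)}, IsSemialgebraic ℚ W → ∀ {n : ℕ} (U : Fin n → Fin (m + 2)) {X : (Fin d → ℝ) → Fin n → ℝ} {P Q : (Fin d → ℝ) → ℝ}, (∀ i, IsSemialgebraicFunOn ℚ W fun z => X z i) → IsSemialgebraicFunOn ℚ W P → IsSemialgebraicFunOn ℚ W Q → IsSemialgebraicFunOn ℚ W fun z => Ht U (X z) (P z) (Q z)) ∧
    (∀ {d : ℕ} {W : Set (Fin d → ℝ)}, IsSemialgebraic ℚ W → ∀ {n : ℕ} (V : Fin n → Fin (m + 2)) {Y : (Fin d → ℝ) → Fin n → ℝ} {P Q : (Fin d → ℝ) → ℝ}, (∀ i, IsSemialgebraicFunOn ℚ W fun z => Y z i) → IsSemialgebraicFunOn ℚ W P → IsSemialgebraicFunOn ℚ W Q → IsSemialgebraicFunOn ℚ W fun z => Vt V (Y z) (P z) (Q z)) ∧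
    (∀ {d : ℕ} {W : Set (Fin d → ℝ)}, IsSemialgebraic ℚ W → ∀ {n : ℕ} (U : Fin n → Fin (m + 2)) {X : (Fin d → ℝ) → Fin n → ℝ} {P Q : (Fin d → ℝ) → ℝ}, (∀ i, IsSemialgebraicFunOn ℚ W fun z => X z i) → IsSemialgebraicFunOn ℚ W P → IsSemialgebraicFunOn ℚ W Q → IsSemialgebraicFunOn ℚ W fun z => dHt U (X z) (P z) (Q z)) ∧
    (∀ {d : ℕ} {W : Set (Fin d → ℝ)}, IsSemialgebraic ℚ W → ∀ {n : ℕ} (V : Fin n → Fin (m + 2)) {Y : (Fin d → ℝ) → Fin n → ℝ} {P Q : (Fin d → ℝ) → ℝ}, (∀ i, IsSemialgebraicFunOn ℚ W fun z => Y z i) → IsSemialgebraicFunOn ℚ W P → IsSemialgebraicFunOn ℚ W Q → IsSemialgebraicFunOn ℚ W fun z => dVt V (Y z) (P z) (Q z)) ∧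
    (∃ C : ℝ, ∀ (a : Fin (m + 2)) (ξ η : ℝ), 0 ≤ ξ → ξ ≤ (α : ℝ) → 0 ≤ η → η ≤ (β : ℝ) → (a ≠ ℓ → |fd a ξ η| ≤ C) ∧ (a ≠ ℓ' → |gd a ξ η| ≤ C) ∧ |dd a ξ η| ≤ C ∧ (∀ η' : ℝ, 0 ≤ η' → η' ≤ (β : ℝ) → |fd a ξ η - fd a ξ η'| ≤ C * |η - η'|) ∧ (∀ ξ' : ℝ, 0 ≤ ξ' → ξ' ≤ (α : ℝ) → |gd a ξ η - gd a ξ' η| ≤ C * |ξ - ξ'|)) ∧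
    (∀ k : ℕ, ∃ C : ℝ, ∀ (U : Fin k → Fin (m + 2)) (x : Fin k → ℝ) (ξ η : ℝ), (∀ i, 0 ≤ x i ∧ x i ≤ 1) → 0 ≤ ξ → ξ ≤ (α : ℝ) → 0 ≤ η → η ≤ (β : ℝ) → |Ht U x ξ η| ≤ C ∧ |dHt U x ξ η| ≤ C ∧ (0 < k → |Ht U x ξ η| ≤ C * ξ) ∧ (∀ η' : ℝ, 0 ≤ η' → η' ≤ (β : ℝ) → |Ht U x ξ η - Ht U x ξ η'| ≤ C * ξ * |η - η'|)) ∧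
    (∀ l : ℕ, ∃ C : ℝ, ∀ (V : Fin l → Fin (m + 2)) (y : Fin l → ℝ) (ξ η : ℝ), (∀ i, 0 ≤ y i ∧ y i ≤ 1) → 0 ≤ ξ → ξ ≤ (α : ℝ) → 0 ≤ η → η ≤ (β : ℝ) → |Vt V y ξ η| ≤ C ∧ |dVt V y ξ η| ≤ C ∧ (0 < l → |Vt V y ξ η| ≤ C * η) ∧ (∀ ξ' : ℝ, 0 ≤ ξ' → ξ' ≤ (α : ℝ) → |Vt V y ξ η - Vt V y ξ' η| ≤ C * η * |ξ - ξ'|)))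
/-! ### Existence of `Q a` and `E a` -/

/-- Prepending a coordinate in `(0,1)` to a point of the open cube gives a point of the open cube.
[folklore] -/
theorem qe_cons_mem_open {l : ℕ} (t : ℝ) (y : Fin l → ℝ) (ht : 0 < t) (ht1 : t < 1)
    (hy : ∀ j, 0 < y j ∧ y j < 1) :
    ∀ j : Fin (l + 1), 0 < (Fin.cons t y : Fin (l + 1) → ℝ) j ∧ (Fin.cons t y : Fin (l + 1) → ℝ) j < 1 := by
  refine Fin.cases ?_ (fun j => ?_)
  · simp only [Fin.cons_zero]; exact ⟨ht, ht1⟩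
  · simp only [Fin.cons_succ]; exact hy j


include H in
/-- **The height differences `Q a` exist** (bounded on the open cube by a multiple of the
admissibility constant, via the master bound). [folklore] -/
theorem qe_exists_Q (μ : (DrinfeldKohnoTrunc ℚ (Fin 4) N) →ₗ[ℚ] ℚ) (e : ℕ) (Ξ Η σ : (Fin e → ℝ) → ℝ)
    (hΞΗ : ∀ θ ∈ KZ.cube e, 0 ≤ Ξ θ ∧ Ξ θ ≤ (α : ℝ) ∧ 0 ≤ Η θ ∧ Η θ ≤ (β : ℝ))
    (hsaΞ : IsSemialgebraicFunOn ℚ (KZ.cube e) Ξ) (hsaΗ : IsSemialgebraicFunOn ℚ (KZ.cube e) Η)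
    (hsaσ : IsSemialgebraicFunOn ℚ (KZ.cube e) σ) (hb : ∃ C : ℝ, ∀ θ ∈ KZ.cube e, |σ θ| * Ξ θ * Η θ ≤ C)
    (Ξ₁ Η₁ ρ : (Fin (e + 1) → ℝ) → ℝ)
    (hΞ₁ : ∀ θ', Ξ₁ θ' = Ξ (Fin.init θ') * θ' (Fin.last e)) (hΗ₁ : ∀ θ', Η₁ θ' = Η (Fin.init θ'))
    (hρ : ∀ θ', ρ θ' = σ (Fin.init θ') * Ξ (Fin.init θ')) (k l : ℕ) (a : Fin (m + 2)) :
    ∃ Q : KZ.IntegralRep (k + l + (e + 1)), Q.domain = KZ.cube (k + l + (e + 1)) ∧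
      Q.integrand = fun w => ρ (Θb k l (e + 1) w) *
        (fd a (Ξ₁ (Θb k l (e + 1) w)) (Η₁ (Θb k l (e + 1) w)) *
            Bf (μ ∘ₗ op a) (Xb k l (e + 1) w) (Yb k l (e + 1) w) (Ξ₁ (Θb k l (e + 1) w)) (Η₁ (Θb k l (e + 1) w)) -
          fd a (Ξ₁ (Θb k l (e + 1) w)) 0 *
            Bf (μ ∘ₗ op a) (Xb k l (e + 1) w) (Yb k l (e + 1) w) (Ξ₁ (Θb k l (e + 1) w)) 0) := by
  have hW := KZ.isSemialgebraic_cube (n := k + l + (e + 1))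
  obtain ⟨hX, hY, hΘ, hcomp⟩ := qe_sa_blocks H k l (e + 1)
  have hsaB := fun (ν : (DrinfeldKohnoTrunc ℚ (Fin 4) N) →ₗ[ℚ] ℚ) {P Q : (Fin (k + l + (e + 1)) → ℝ) → ℝ}
    (hP : IsSemialgebraicFunOn ℚ _ P) (hQ : IsSemialgebraicFunOn ℚ _ Q) => qe_sa_Bf H hW ν hX hY hP hQ
  obtain ⟨K, hK0, hK⟩ := qe_master_bound H μ k l
  have hbm := fun (w : Fin (k + l + (e + 1)) → ℝ) (hw : w ∈ openUnitCube (k + l + (e + 1))) =>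
    qe_blocks_mem_open H hw
  obtain ⟨_, _, _, _, _, _, _, _, _, _, _, _, _, _, _, _, _, _, _, _, _, _, _, _, _, _, _, _, _, _, _, _, _,
    _, _, _, _, hsa_fd, -⟩ := H
  refine qe_exists_rep_cube_of_bound _ ?_ ?_
  · -- semialgebraicity
    have hθ₀ : ∀ g : (Fin e → ℝ) → ℝ, IsSemialgebraicFunOn ℚ (KZ.cube e) g →
        IsSemialgebraicFunOn ℚ (KZ.cube (k + l + (e + 1))) fun w => g (Fin.init (Θb k l (e + 1) w)) :=
      fun g hg => hcomp Fin.castSucc g hg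
    have hΞ₁sa : IsSemialgebraicFunOn ℚ (KZ.cube (k + l + (e + 1))) fun w => Ξ₁ (Θb k l (e + 1) w) :=
      ((hθ₀ Ξ hsaΞ).fun_mul (hΘ (Fin.last e))).congr fun w _ => (hΞ₁ _).symm
    have hΗ₁sa : IsSemialgebraicFunOn ℚ (KZ.cube (k + l + (e + 1))) fun w => Η₁ (Θb k l (e + 1) w) :=
      (hθ₀ Η hsaΗ).congr fun w _ => (hΗ₁ _).symm
    have hρsa : IsSemialgebraicFunOn ℚ (KZ.cube (k + l + (e + 1))) fun w => ρ (Θb k l (e + 1) w) :=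
      ((hθ₀ σ hsaσ).fun_mul (hθ₀ Ξ hsaΞ)).congr fun w _ => (hρ _).symm
    have h0 : IsSemialgebraicFunOn ℚ (KZ.cube (k + l + (e + 1))) fun _ => (0 : ℝ) :=
      (isSemialgebraicFunOn_const_ratCast hW 0).congr fun _ _ => Rat.cast_zero
    exact hρsa.fun_mul (((hsa_fd hW a hΞ₁sa hΗ₁sa).fun_mul (hsaB _ hΞ₁sa hΗ₁sa)).fun_sub
      ((hsa_fd hW a hΞ₁sa h0).fun_mul (hsaB _ hΞ₁sa h0)))
  · -- bound on the open cube
    obtain ⟨C₀, hC₀⟩ := hb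
    refine ⟨C₀ * K, fun w hw => ?_⟩
    obtain ⟨hx, hy, hθ⟩ := hbm w hw
    set x := Xb k l (e + 1) w
    set y := Yb k l (e + 1) w
    set Θ := Θb k l (e + 1) w
    have hθ₀ : Fin.init Θ ∈ KZ.cube e :=
      KZ.mem_cube.2 fun i => ⟨(hθ (Fin.castSucc i)).1.le, (hθ (Fin.castSucc i)).2.le⟩
    obtain ⟨hΞ0, hΞα, hΗ0, hΗβ⟩ := hΞΗ _ hθ₀
    have hs := hθ (Fin.last e)
    have hC₀' := hC₀ _ hθ₀
    have hC₀0 : 0 ≤ C₀ := (mul_nonneg (mul_nonneg (abs_nonneg _) hΞ0) hΗ0).trans hC₀'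
    have hx' : ∀ i, 0 ≤ x i ∧ x i ≤ 1 := fun i => ⟨(hx i).1.le, (hx i).2.le⟩
    show |ρ Θ * (fd a (Ξ₁ Θ) (Η₁ Θ) * Bf (μ ∘ₗ op a) x y (Ξ₁ Θ) (Η₁ Θ) -
      fd a (Ξ₁ Θ) 0 * Bf (μ ∘ₗ op a) x y (Ξ₁ Θ) 0)| ≤ C₀ * K
    rw [hρ, hΞ₁, hΗ₁]
    rcases hΞ0.eq_or_lt with hΞz | hΞpos
    · rw [← hΞz, mul_zero, zero_mul, abs_zero]; positivity
    have hξpos : 0 < Ξ (Fin.init Θ) * Θ (Fin.last e) := mul_pos hΞpos hs.1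
    have hξα : Ξ (Fin.init Θ) * Θ (Fin.last e) ≤ (α : ℝ) := (mul_le_of_le_one_right hΞ0 hs.2.le).trans hΞα
    have hmain := (hK a x y _ _ 0 hx' hy hξpos hξα hΗ0 hΗβ le_rfl (hΗ0.trans hΗβ)).2
    rw [abs_mul, abs_mul, abs_of_nonneg hΞ0]
    calc _ ≤ |σ (Fin.init Θ)| * Ξ (Fin.init Θ) * (K * Η (Fin.init Θ)) :=
          mul_le_mul_of_nonneg_left hmain (mul_nonneg (abs_nonneg _) hΞ0)
      _ = (|σ (Fin.init Θ)| * Ξ (Fin.init Θ) * Η (Fin.init Θ)) * K := by ring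
      _ ≤ C₀ * K := mul_le_mul_of_nonneg_right hC₀' hK0

include H in
/-- **The level-`(n−2)` terms `E a` exist** (bounded on the open cube: after reverse peeling the
integrand is `ρ₂ fd_a(Ξ₂,Η₂) B^{μ∘op a}_{k,l+1}(x, Η₂/β :: y; Ξ₂, β) / β`, and the master bound in
degree `(k, l+1)` applies). [folklore] -/
theorem qe_exists_E (μ : (DrinfeldKohnoTrunc ℚ (Fin 4) N) →ₗ[ℚ] ℚ) (e : ℕ) (Ξ Η σ : (Fin e → ℝ) → ℝ)
    (hΞΗ : ∀ θ ∈ KZ.cube e, 0 ≤ Ξ θ ∧ Ξ θ ≤ (α : ℝ) ∧ 0 ≤ Η θ ∧ Η θ ≤ (β : ℝ))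
    (hsaΞ : IsSemialgebraicFunOn ℚ (KZ.cube e) Ξ) (hsaΗ : IsSemialgebraicFunOn ℚ (KZ.cube e) Η)
    (hsaσ : IsSemialgebraicFunOn ℚ (KZ.cube e) σ) (hb : ∃ C : ℝ, ∀ θ ∈ KZ.cube e, |σ θ| * Ξ θ * Η θ ≤ C)
    (Ξ₂ Η₂ ρ₂ : (Fin (e + 2) → ℝ) → ℝ)
    (hΞ₂ : ∀ θ'', Ξ₂ θ'' = Ξ (Fin.init (Fin.init θ'')) * θ'' (Fin.castSucc (Fin.last e)))
    (hΗ₂ : ∀ θ'', Η₂ θ'' = Η (Fin.init (Fin.init θ'')) * θ'' (Fin.last (e + 1)))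
    (hρ₂ : ∀ θ'', ρ₂ θ'' = σ (Fin.init (Fin.init θ'')) * Ξ (Fin.init (Fin.init θ'')) * Η (Fin.init (Fin.init θ'')))
    (k l : ℕ) (a : Fin (m + 2)) :
    ∃ E : KZ.IntegralRep (k + l + (e + 2)), E.domain = KZ.cube (k + l + (e + 2)) ∧
      E.integrand = fun w => ρ₂ (Θb k l (e + 2) w) *
        (fd a (Ξ₂ (Θb k l (e + 2) w)) (Η₂ (Θb k l (e + 2) w)) *
          ∑ b : Fin (m + 2), gd b (Ξ₂ (Θb k l (e + 2) w)) (Η₂ (Θb k l (e + 2) w)) *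
            Bf ((μ ∘ₗ op a) ∘ₗ opV b) (Xb k l (e + 2) w) (Yb k l (e + 2) w)
              (Ξ₂ (Θb k l (e + 2) w)) (Η₂ (Θb k l (e + 2) w))) := by
  have hW := KZ.isSemialgebraic_cube (n := k + l + (e + 2))
  obtain ⟨hX, hY, hΘ, hcomp⟩ := qe_sa_blocks H k l (e + 2)
  have hsaB := fun (ν : (DrinfeldKohnoTrunc ℚ (Fin 4) N) →ₗ[ℚ] ℚ) {P Q : (Fin (k + l + (e + 2)) → ℝ) → ℝ}
    (hP : IsSemialgebraicFunOn ℚ _ P) (hQ : IsSemialgebraicFunOn ℚ _ Q) => qe_sa_Bf H hW ν hX hY hP hQ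
  obtain ⟨K, hK0, hK⟩ := qe_master_bound H μ k (l + 1)
  have hpeel := fun (x : Fin k → ℝ) (y : Fin l → ℝ) (ξ η : ℝ) => qe_sum_gd_Bf H μ a x y ξ η
  have hzero := fun (x : Fin k → ℝ) (y : Fin (l + 1) → ℝ) (ξ : ℝ) => qe_Bf_eta_zero H (μ ∘ₗ op a) x y ξ
  have hbm := fun (w : Fin (k + l + (e + 2)) → ℝ) (hw : w ∈ openUnitCube (k + l + (e + 2))) =>
    qe_blocks_mem_open H hw
  obtain ⟨_, _, _, _, _, _, _, _, _, _, _, _, _, _, _, _, _, _, _, _, _, _, _, _, _, _, _, _, _, _, _, _, _,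
    _, _, _, _, hsa_fd, hsa_gd, -⟩ := H
  refine qe_exists_rep_cube_of_bound _ ?_ ?_
  · -- semialgebraicity
    have hθ₀ : ∀ g : (Fin e → ℝ) → ℝ, IsSemialgebraicFunOn ℚ (KZ.cube e) g →
        IsSemialgebraicFunOn ℚ (KZ.cube (k + l + (e + 2))) fun w => g (Fin.init (Fin.init (Θb k l (e + 2) w))) :=
      fun g hg => hcomp (fun i => Fin.castSucc (Fin.castSucc i)) g hg
    have hΞ₂sa : IsSemialgebraicFunOn ℚ (KZ.cube (k + l + (e + 2))) fun w => Ξ₂ (Θb k l (e + 2) w) :=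
      ((hθ₀ Ξ hsaΞ).fun_mul (hΘ (Fin.castSucc (Fin.last e)))).congr fun w _ => (hΞ₂ _).symm
    have hΗ₂sa : IsSemialgebraicFunOn ℚ (KZ.cube (k + l + (e + 2))) fun w => Η₂ (Θb k l (e + 2) w) :=
      ((hθ₀ Η hsaΗ).fun_mul (hΘ (Fin.last (e + 1)))).congr fun w _ => (hΗ₂ _).symm
    have hρ₂sa : IsSemialgebraicFunOn ℚ (KZ.cube (k + l + (e + 2))) fun w => ρ₂ (Θb k l (e + 2) w) :=
      (((hθ₀ σ hsaσ).fun_mul (hθ₀ Ξ hsaΞ)).fun_mul (hθ₀ Η hsaΗ)).congr fun w _ => (hρ₂ _).symm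
    exact hρ₂sa.fun_mul ((hsa_fd hW a hΞ₂sa hΗ₂sa).fun_mul
      (IsSemialgebraicFunOn.fun_finsetSum Finset.univ hW fun b _ =>
        (hsa_gd hW b hΞ₂sa hΗ₂sa).fun_mul (hsaB _ hΞ₂sa hΗ₂sa)))
  · -- bound on the open cube
    obtain ⟨C₀, hC₀⟩ := hb
    refine ⟨C₀ * K, fun w hw => ?_⟩
    obtain ⟨hx, hy, hθ⟩ := hbm w hw
    set x := Xb k l (e + 2) w
    set y := Yb k l (e + 2) w
    set Θ := Θb k l (e + 2) w
    have hθ₀ : Fin.init (Fin.init Θ) ∈ KZ.cube e :=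
      KZ.mem_cube.2 fun i => ⟨(hθ (Fin.castSucc (Fin.castSucc i))).1.le, (hθ (Fin.castSucc (Fin.castSucc i))).2.le⟩
    obtain ⟨hΞ0, hΞα, hΗ0, hΗβ⟩ := hΞΗ _ hθ₀
    have hs := hθ (Fin.castSucc (Fin.last e))
    have hs' := hθ (Fin.last (e + 1))
    have hC₀' := hC₀ _ hθ₀
    have hC₀0 : 0 ≤ C₀ := (mul_nonneg (mul_nonneg (abs_nonneg _) hΞ0) hΗ0).trans hC₀'
    have hx' : ∀ i, 0 ≤ x i ∧ x i ≤ 1 := fun i => ⟨(hx i).1.le, (hx i).2.le⟩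
    show |ρ₂ Θ * (fd a (Ξ₂ Θ) (Η₂ Θ) * ∑ b : Fin (m + 2), gd b (Ξ₂ Θ) (Η₂ Θ) *
      Bf ((μ ∘ₗ op a) ∘ₗ opV b) x y (Ξ₂ Θ) (Η₂ Θ))| ≤ C₀ * K
    by_cases hz : Ξ (Fin.init (Fin.init Θ)) = 0 ∨ Η (Fin.init (Fin.init Θ)) = 0
    · have : ρ₂ Θ = 0 := by rw [hρ₂]; rcases hz with h | h <;> simp [h]
      rw [this, zero_mul, abs_zero]; positivity
    push Not at hz
    have hΞpos : 0 < Ξ (Fin.init (Fin.init Θ)) := lt_of_le_of_ne hΞ0 (Ne.symm hz.1)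
    have hΗpos : 0 < Η (Fin.init (Fin.init Θ)) := lt_of_le_of_ne hΗ0 (Ne.symm hz.2)
    set ξ := Ξ₂ Θ with hξdef
    set η := Η₂ Θ with hηdef
    have hξpos : 0 < ξ := by rw [hξdef, hΞ₂]; exact mul_pos hΞpos hs.1
    have hξα : ξ ≤ (α : ℝ) := by rw [hξdef, hΞ₂]; exact (mul_le_of_le_one_right hΞ0 hs.2.le).trans hΞα
    have hηpos : 0 < η := by rw [hηdef, hΗ₂]; exact mul_pos hΗpos hs'.1
    have hηβ : η < (β : ℝ) := by rw [hηdef, hΗ₂]; exact (mul_lt_of_lt_one_right hΗpos hs'.2).trans_le hΗβ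
    have hβpos : (0 : ℝ) < β := hηpos.trans hηβ
    have hsum : ∑ b : Fin (m + 2), gd b ξ η * Bf ((μ ∘ₗ op a) ∘ₗ opV b) x y ξ η =
        (1 / (β : ℝ)) * Bf (μ ∘ₗ op a) x (Fin.cons (η / β) y) ξ β := by
      rw [← hpeel x y ξ η hx hξpos hξα hβpos.ne', one_div, inv_mul_cancel_left₀ hβpos.ne']
    have hyc := qe_cons_mem_open (η / β) y (div_pos hηpos hβpos) ((div_lt_one hβpos).2 hηβ) hy
    have hmain := (hK a x (Fin.cons (η / β) y) ξ β η hx' hyc hξpos hξα hβpos.le le_rfl hηpos.le hηβ.le).1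
    rw [hzero, sub_zero] at hmain
    rw [hsum, hρ₂, abs_mul, abs_mul, abs_mul, abs_mul, abs_mul, abs_of_nonneg hΞ0, abs_of_nonneg hΗ0,
      abs_of_pos (one_div_pos.2 hβpos)]
    calc _ = |σ (Fin.init (Fin.init Θ))| * Ξ (Fin.init (Fin.init Θ)) * Η (Fin.init (Fin.init Θ)) *
          (1 / (β : ℝ)) * (|fd a ξ η| * |Bf (μ ∘ₗ op a) x (Fin.cons (η / β) y) ξ β|) := by ring
      _ ≤ C₀ * (1 / (β : ℝ)) * (K * β) :=
          mul_le_mul (mul_le_mul_of_nonneg_right hC₀' (by positivity)) hmain (by positivity) (by positivity)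
      _ = C₀ * K := by field_simp

include H in
/-- **The height differences `Q a` and the level-`(n−2)` terms `E a` of Step A exist** for
normalised data (bounded on the OPEN cube; for the regularised letters this uses the centrality of
the edge transports and of the letters). [folklore] -/
theorem exists_stepA_QE (μ : (DrinfeldKohnoTrunc ℚ (Fin 4) N) →ₗ[ℚ] ℚ) (e : ℕ) (Ξ Η σ : (Fin e → ℝ) → ℝ)
    (hΞΗ : ∀ θ ∈ KZ.cube e, 0 ≤ Ξ θ ∧ Ξ θ ≤ (α : ℝ) ∧ 0 ≤ Η θ ∧ Η θ ≤ (β : ℝ))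
    (hsaΞ : IsSemialgebraicFunOn ℚ (KZ.cube e) Ξ) (hsaΗ : IsSemialgebraicFunOn ℚ (KZ.cube e) Η)
    (hsaσ : IsSemialgebraicFunOn ℚ (KZ.cube e) σ) (hb : ∃ C : ℝ, ∀ θ ∈ KZ.cube e, |σ θ| * Ξ θ * Η θ ≤ C)
    (hσ0 : ∀ θ ∈ KZ.cube e, Ξ θ = 0 ∨ Η θ = 0 → σ θ = 0)
    (Ξ₁ Η₁ ρ : (Fin (e + 1) → ℝ) → ℝ) (σw : Fin (m + 2) → (Fin (e + 1) → ℝ) → ℝ)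
    (hΞ₁ : ∀ θ', Ξ₁ θ' = Ξ (Fin.init θ') * θ' (Fin.last e)) (hΗ₁ : ∀ θ', Η₁ θ' = Η (Fin.init θ'))
    (hρ : ∀ θ', ρ θ' = σ (Fin.init θ') * Ξ (Fin.init θ'))
    (hσw : ∀ a θ', σw a θ' = ρ θ' * fd a (Ξ₁ θ') (Η₁ θ'))
    (Ξ₂ Η₂ ρ₂ : (Fin (e + 2) → ℝ) → ℝ)
    (hΞ₂ : ∀ θ'', Ξ₂ θ'' = Ξ (Fin.init (Fin.init θ'')) * θ'' (Fin.castSucc (Fin.last e)))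
    (hΗ₂ : ∀ θ'', Η₂ θ'' = Η (Fin.init (Fin.init θ'')) * θ'' (Fin.last (e + 1)))
    (hρ₂ : ∀ θ'', ρ₂ θ'' = σ (Fin.init (Fin.init θ'')) * Ξ (Fin.init (Fin.init θ'')) * Η (Fin.init (Fin.init θ'')))
    (k l : ℕ) :
    (∀ a, ∃ Q : KZ.IntegralRep (k + l + (e + 1)), Q.domain = KZ.cube (k + l + (e + 1)) ∧
      Q.integrand = fun w => ρ (Θb k l (e + 1) w) *
        (fd a (Ξ₁ (Θb k l (e + 1) w)) (Η₁ (Θb k l (e + 1) w)) *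
            Bf (μ ∘ₗ op a) (Xb k l (e + 1) w) (Yb k l (e + 1) w) (Ξ₁ (Θb k l (e + 1) w)) (Η₁ (Θb k l (e + 1) w)) -
          fd a (Ξ₁ (Θb k l (e + 1) w)) 0 *
            Bf (μ ∘ₗ op a) (Xb k l (e + 1) w) (Yb k l (e + 1) w) (Ξ₁ (Θb k l (e + 1) w)) 0)) ∧
    (∀ a, ∃ E : KZ.IntegralRep (k + l + (e + 2)), E.domain = KZ.cube (k + l + (e + 2)) ∧
      E.integrand = fun w => ρ₂ (Θb k l (e + 2) w) *
        (fd a (Ξ₂ (Θb k l (e + 2) w)) (Η₂ (Θb k l (e + 2) w)) *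
          ∑ b : Fin (m + 2), gd b (Ξ₂ (Θb k l (e + 2) w)) (Η₂ (Θb k l (e + 2) w)) *
            Bf ((μ ∘ₗ op a) ∘ₗ opV b) (Xb k l (e + 2) w) (Yb k l (e + 2) w)
              (Ξ₂ (Θb k l (e + 2) w)) (Η₂ (Θb k l (e + 2) w)))) := by
  have _ := hσ0
  have _ := hσw
  exact ⟨fun a => qe_exists_Q H μ e Ξ Η σ hΞΗ hsaΞ hsaΗ hsaσ hb Ξ₁ Η₁ ρ hΞ₁ hΗ₁ hρ k l a,
    fun a => qe_exists_E H μ e Ξ Η σ hΞΗ hsaΞ hsaΗ hsaσ hb Ξ₂ Η₂ ρ₂ hΞ₂ hΗ₂ hρ₂ k l a⟩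

end AbstractEngine

/-- **Hook `cornerEngineQE_cons_mem_open`** (registered form of `qe_cons_mem_open`): prepending a coordinate in
`(0,1)` to a point of the open cube gives a point of the open cube. [folklore] -/
theorem cornerEngineQE_cons_mem_open : ∀ (l : ℕ) (t : ℝ) (y : Fin l → ℝ), 0 < t → t < 1 → (∀ j, 0 < y j ∧ y j < 1) → ∀ j : Fin (l + 1), 0 < (Fin.cons t y : Fin (l + 1) → ℝ) j ∧ (Fin.cons t y : Fin (l + 1) → ℝ) j < 1 :=
  fun _ t y ht ht1 hy => qe_cons_mem_open t y ht ht1 hy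

end Summit.KontsevichZagierPeriods.FurushoPentagon.PentagonInKZ
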